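import Summits.NavierStokesRegularity.NavierStokesRegularity.Theorems.TerminalTraceExtinctApexZoomAux
import Summits.NavierStokesRegularity.NavierStokesRegularity.Theorems.TerminalTraceExtinctApexCompactness
import Summits.NavierStokesRegularity.NavierStokesRegularity.Theorems.TerminalTraceExtinctApexPairingModulus
import HarnessLib

/-!
# Crux `TerminalTrace.TypeITraceScarL3` (stmt-NavierStokesRegularity-18385), STUB 2 support file 5b:
# the zoom at a prescribed backward-singular vertex WITH AN `L³` TOP SLICE is an EXTINCT Type-I apex

Prover seat nsreg-p4 (gen 15); `--supports stmt-NavierStokesRegularity-18385`.  Theorems only.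

`exists_extinctApex_zoomLimit`: for `(u, p)` in Albritton–Barker's class Def. 2.1 on `Q(z₀, ρ)`
with a weak gradient `G`, `𝐈(Q(z₀, ρ)) < ∞`, the pointwise Type-I rate `M/√(t₀ − t)`, a backward
singular vertex `z₀ = (t₀, x₀)`, a top slice `u(t₀) ∈ L³(B(x₀, ρ))` (a.e.-strongly measurable) and
weakly continuous pairings `∫ ⟪u(t), η⟫ → ∫ ⟪u(t₀), η⟫` (`t ↑ t₀`, `η ∈ C_c^∞`), the parabolic zooms
`λ u(t₀ + λ²s, x₀ + λy)`, `λ = ρ/2^{k+2}`, converge along a subsequence to an EXTINCT TYPE-I APEX: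
class Def. 2.1 and weak gradient on every `Q(0, a)`, `𝐈(Q(0,a)) ≤ M_b`, rate `C/√(−s)`, backward
singular origin, and NULL WEAK TOP TRACE (`∀ φ ε, ∃ s₀ < 0, |∫ ⟪U(s), φ⟫| ≤ ε` a.e. on `]s₀,0[`).
Steps 1–5 are the tree's `LocalTypeIBlowup.exists_typeIAncientMild_zoomLimit` (adapted from
`Literature/Analysis/FluidPDE/LocalTypeIBlowup/SingularVertexZoom.lean`; Barker–Prange 2020 §4,
Seregin–Šverák 2009 Thm 2.8, Albritton–Barker 2019 Prop. 2.3) with `local_typeI_compactness_inBall`;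
Step 6 (Seregin, *Lecture notes* (2014), §6.6 p. 127 / Prop. 6.20) feeds the uniform modulus
`ae_abs_pairing_sub_top_le` (from `A ≤ 𝐈` and `eLpNorm_pressure_ball_le` on the unit-ball-normalised
pressures), the vanishing top values `tendsto_setIntegral_inner_zoom_zero`, and the limit passage
`ae_abs_setIntegral_inner_le_of_tendsto`.

WHAT THIS IS NOT: not a regularity or blow-up claim — the blow-up procedure at a hypothetical
Type-I singular point; the crux `TypeITraceScarL3` and its open stubs are untouched.
-/

noncomputable section

open MeasureTheory Set Function Filter Topology TopologicalSpace Metric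
open scoped NNReal ENNReal InnerProductSpace RealInnerProductSpace Laplacian
open Literature.Analysis Literature.Analysis.FluidPDE Literature.Analysis.FluidPDE.LocalTypeIBlowup
open Summit.NavierStokesRegularity.NavierStokesRegularity.Theorems.TerminalTraceExtinctApexCompactness
open Summit.NavierStokesRegularity.NavierStokesRegularity.Theorems.TerminalTraceExtinctApexPairing
open Summit.NavierStokesRegularity.NavierStokesRegularity.Theorems.TerminalTraceExtinctApexTopTrace

namespace Summit.NavierStokesRegularity.NavierStokesRegularity.Theorems.TerminalTraceExtinctApexZoom

/-! ## The zoom at a prescribed vertex with an `L³` top slice -/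

/-- **The zoom at a prescribed backward-singular vertex with an `L³` top slice is an EXTINCT
Type-I apex** (Barker–Prange 2020 §4 Steps 2–3 / Seregin–Šverák 2009 Thm 2.8 / Albritton–Barker
2019 Prop. 2.3 for Steps 1–5; Seregin 2014 §6.6 p. 127 for the null top trace).  See the module
docstring. -/
theorem exists_extinctApex_zoomLimit
    {u : ℝ → (EuclideanSpace ℝ (Fin 3)) → (EuclideanSpace ℝ (Fin 3))}
    {p : ℝ → (EuclideanSpace ℝ (Fin 3)) → ℝ}
    {G : ℝ → (EuclideanSpace ℝ (Fin 3)) → (EuclideanSpace ℝ (Fin 3)) →L[ℝ] (EuclideanSpace ℝ (Fin 3))}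
    {z₀ : ℝ × (EuclideanSpace ℝ (Fin 3))} {ρ M : ℝ} (hρ : 0 < ρ)
    (hball : IsSuitableWeakSolutionInBall ρ z₀ u p)
    (hwg : HasWeakSpatialGradientOn (parabolicCylinderOpens ρ z₀) u G)
    (hI : typeIBound (parabolicCylinder ρ z₀) u p G < ⊤)
    (hrate : ∀ (t : ℝ) (x : EuclideanSpace ℝ (Fin 3)), (t, x) ∈ parabolicCylinder ρ z₀ →
      ‖u t x‖ ≤ M / Real.sqrt (z₀.1 - t))
    (hsing : IsBackwardSingularPoint u z₀)
    (htop : MemLp (u z₀.1) 3 (volume.restrict (ball z₀.2 ρ)))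
    (htopm : AEStronglyMeasurable (u z₀.1) volume)
    (hwc : ∀ η : EuclideanSpace ℝ (Fin 3) → EuclideanSpace ℝ (Fin 3), ContDiff ℝ (⊤ : ℕ∞) η →
      HasCompactSupport η →
      Tendsto (fun t => ∫ x, ⟪u t x, η x⟫) (𝓝[<] z₀.1) (𝓝 (∫ x, ⟪u z₀.1 x, η x⟫))) :
    ∃ (U : ℝ → (EuclideanSpace ℝ (Fin 3)) → (EuclideanSpace ℝ (Fin 3)))
      (P : ℝ → (EuclideanSpace ℝ (Fin 3)) → ℝ)
      (H : ℝ → (EuclideanSpace ℝ (Fin 3)) → (EuclideanSpace ℝ (Fin 3)) →L[ℝ] (EuclideanSpace ℝ (Fin 3)))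
      (Mb : ℝ≥0) (C : ℝ),
      (∀ a : ℝ, 0 < a →
        IsSuitableWeakSolutionInBall a (0 : ℝ × EuclideanSpace ℝ (Fin 3)) U P) ∧
      (∀ a : ℝ, 0 < a →
        HasWeakSpatialGradientOn
          (parabolicCylinderOpens a (0 : ℝ × EuclideanSpace ℝ (Fin 3))) U H) ∧
      (∀ a : ℝ, 0 < a →
        typeIBound (parabolicCylinder a (0 : ℝ × EuclideanSpace ℝ (Fin 3))) U P H ≤ Mb) ∧
      (∀ s : ℝ, s < 0 →
        ∀ᵐ y : EuclideanSpace ℝ (Fin 3), ‖U s y‖ ≤ C / Real.sqrt (-s)) ∧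
      (∀ φ : EuclideanSpace ℝ (Fin 3) → EuclideanSpace ℝ (Fin 3),
        ContDiff ℝ (⊤ : ℕ∞) φ →
        HasCompactSupport φ → ∀ ε : ℝ, 0 < ε →
        ∃ s₀ : ℝ, s₀ < 0 ∧ ∀ᵐ s ∂(volume.restrict (Ioo s₀ 0)), |∫ y, ⟪U s y, φ y⟫| ≤ ε) ∧
      IsBackwardSingularPoint U (0 : ℝ × EuclideanSpace ℝ (Fin 3)) := by
  -- ## constants
  have hρ2 : 0 < ρ ^ 2 := pow_pos hρ 2
  have hM : 0 ≤ M := by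
    have hmem : ((z₀.1 - ρ ^ 2 / 2, z₀.2) : ℝ × (EuclideanSpace ℝ (Fin 3))) ∈ parabolicCylinder ρ z₀ := by
      rw [mem_parabolicCylinder]
      exact ⟨⟨by linarith, by linarith⟩, by simp [hρ]⟩
    have h := hrate _ _ hmem
    have hs : 0 < Real.sqrt (z₀.1 - (z₀.1 - ρ ^ 2 / 2)) := Real.sqrt_pos.2 (by linarith)
    by_contra hM
    push Not at hM
    linarith [norm_nonneg (u (z₀.1 - ρ ^ 2 / 2) z₀.2), div_neg_of_neg_of_pos hM hs]
  have hcc_pos : ∀ m : ℕ, (0 : ℝ) < (2 : ℝ) ^ m := fun m => by positivity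
  have hcc_one : ∀ m : ℕ, (1 : ℝ) ≤ (2 : ℝ) ^ m := fun m => one_le_pow₀ (by norm_num)
  set I : ℝ≥0∞ := typeIBound (parabolicCylinder ρ z₀) u p G with hIdef
  have hItop : I ≠ ⊤ := hI.ne
  -- ## Step 1: the scales `lam k = ρ / 2^(k+2)`
  set lam : ℕ → ℝ := fun k => ρ / (2 : ℝ) ^ (k + 2) with hlam
  have hlam0 : ∀ k, 0 < lam k := fun k => div_pos hρ (hcc_pos _)
  have hbig : ∀ k, (2 : ℝ) ^ (k + 2) ≤ ρ / lam k := fun k => by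
    rw [hlam]
    dsimp only
    rw [div_div_eq_mul_div, mul_div_cancel_left₀ _ hρ.ne']
  have hlamlim : Tendsto lam atTop (𝓝 0) := by
    have h1 : Tendsto (fun k : ℕ => ρ / 4 * (1 / 2 : ℝ) ^ k) atTop (𝓝 (ρ / 4 * 0)) :=
      (tendsto_pow_atTop_nhds_zero_of_lt_one (by norm_num) (by norm_num)).const_mul _
    rw [mul_zero] at h1
    refine h1.congr fun k => ?_
    rw [hlam]
    dsimp only
    rw [pow_add, one_div_pow]
    field_simp
    ring
  -- ## Step 2: the zoomed pairs and their properties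
  set v : ℕ → ℝ → (EuclideanSpace ℝ (Fin 3)) → (EuclideanSpace ℝ (Fin 3)) :=
    fun k => lam k • stPull (lam k ^ 2) (lam k) z₀.1 z₀.2 u with hv
  set qz : ℕ → ℝ → (EuclideanSpace ℝ (Fin 3)) → ℝ :=
    fun k => lam k ^ 2 • stPull (lam k ^ 2) (lam k) z₀.1 z₀.2 p with hqz
  set Gz : ℕ → ℝ → (EuclideanSpace ℝ (Fin 3)) → (EuclideanSpace ℝ (Fin 3)) →L[ℝ] (EuclideanSpace ℝ (Fin 3)) :=
    fun k => lam k ^ 2 • stPull (lam k ^ 2) (lam k) z₀.1 z₀.2 G with hGz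
  -- the class on `Q(0, ρ / lam k)`
  have hInbig : ∀ k, IsSuitableWeakSolutionInBall (ρ / lam k) 0 (v k) (qz k) := by
    intro k
    have h1 := hball.zoom hρ
    set c : ℝ := lam k / ρ with hc
    have hc0 : 0 < c := div_pos (hlam0 k) hρ
    have h2 := h1.zoomOut hc0
    have hcρ : c * ρ = lam k := div_mul_cancel₀ _ hρ.ne'
    have hrad : 1 / c = ρ / lam k := by rw [hc, one_div_div]
    rw [zoom_zoom, zoom_zoom, hcρ, hrad, show c ^ 2 * ρ ^ 2 = lam k ^ 2 by rw [← hcρ]; ring] at h2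
    exact h2
  have hsub : ∀ m k : ℕ, m ≤ k + 2 →
      parabolicCylinder ((2 : ℝ) ^ m) (0 : ℝ × (EuclideanSpace ℝ (Fin 3))) ⊆
        parabolicCylinder (ρ / lam k) (0 : ℝ × (EuclideanSpace ℝ (Fin 3))) := fun m k hmk =>
    parabolicCylinder_mono (hcc_pos m).le ((pow_le_pow_right₀ (by norm_num) hmk).trans (hbig k)) _
  have hballs : ∀ m k : ℕ, m ≤ k + 2 →
      IsSuitableWeakSolutionInBall ((2 : ℝ) ^ m) 0 (v k) (qz k) := fun m k hmk =>
    (hInbig k).of_subset_zero (hcc_pos m) (hsub m k hmk)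
  -- the weak gradients
  have hpre : ∀ k, stPreimage (lam k ^ 2) (lam k) z₀.1 z₀.2 (parabolicCylinderOpens ρ z₀) =
      parabolicCylinderOpens (ρ / lam k) (0 : ℝ × (EuclideanSpace ℝ (Fin 3))) := fun k =>
    Opens.ext (zoom_preimage_parabolicCylinder (hlam0 k) z₀ ρ)
  have hgrads : ∀ m k : ℕ, m ≤ k + 2 →
      HasWeakSpatialGradientOn (parabolicCylinderOpens ((2 : ℝ) ^ m) (0 : ℝ × (EuclideanSpace ℝ (Fin 3))))
        (v k) (Gz k) := by
    intro m k hmk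
    have h1 := hwg.stRescale (lam k) (β := lam k ^ 2) (γ := lam k) (pow_pos (hlam0 k) 2) (hlam0 k)
      z₀.1 z₀.2
    rw [show lam k * lam k = lam k ^ 2 by ring, hpre k] at h1
    exact h1.mono (fun w hw => hsub m k hmk hw)
  -- the Type I bound
  have hIs : ∀ m k : ℕ, m ≤ k + 2 →
      typeIBound (parabolicCylinder ((2 : ℝ) ^ m) (0 : ℝ × (EuclideanSpace ℝ (Fin 3)))) (v k) (qz k) (Gz k) ≤ I := by
    intro m k hmk
    rw [hIdef, ← typeIBound_nsZoom (hlam0 k) z₀.1 z₀.2 (parabolicCylinder ρ z₀) u p G,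
      zoom_preimage_parabolicCylinder (hlam0 k) z₀ ρ]
    exact typeIBound_mono (hsub m k hmk)
  -- blow-up on every `Q(0, r)`: the vertex `z₀` is singular
  have hst0 : ∀ k, stAffine (lam k ^ 2) (lam k) z₀.1 z₀.2 (0 : ℝ × (EuclideanSpace ℝ (Fin 3))) = z₀ := by
    intro k
    rw [show (0 : ℝ × (EuclideanSpace ℝ (Fin 3))) = ((0 : ℝ), (0 : EuclideanSpace ℝ (Fin 3))) from rfl,
      stAffine_apply, mul_zero, add_zero, smul_zero, add_zero]
  have hblow : ∀ k (r : ℝ), 0 < r →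
      eLpNorm (uncurry (v k)) ⊤ (volume.restrict (parabolicCylinder r (0 : ℝ × (EuclideanSpace ℝ (Fin 3))))) = ⊤ := by
    intro k r hr
    show eLpNorm (uncurry (lam k • stPull (lam k ^ 2) (lam k) z₀.1 z₀.2 u)) ⊤ _ = ⊤
    rw [eLpNorm_top_nsZoom (hlam0 k) z₀.1 z₀.2 r 0 u, hst0, hsing (lam k * r) (mul_pos (hlam0 k) hr),
      ENNReal.mul_top (ENNReal.ofReal_pos.2 (hlam0 k)).ne']
  -- the rate on `Q(0, ρ / lam k)`
  have hratev : ∀ k, ∀ w ∈ parabolicCylinder (ρ / lam k) (0 : ℝ × (EuclideanSpace ℝ (Fin 3))),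
      ‖v k w.1 w.2‖ ≤ M / Real.sqrt (-w.1) := by
    rintro k ⟨s, y⟩ hw
    have hmem := zoom_mem_parabolicCylinder (hlam0 k) z₀ hw
    rw [stAffine_apply] at hmem
    have hs0 : s < 0 := by
      rw [mem_parabolicCylinder] at hw
      simpa using hw.1.2
    have h := hrate _ _ hmem
    have hsq : Real.sqrt (z₀.1 - (z₀.1 + lam k ^ 2 * s)) = lam k * Real.sqrt (-s) := by
      rw [show z₀.1 - (z₀.1 + lam k ^ 2 * s) = lam k ^ 2 * (-s) by ring, Real.sqrt_mul (sq_nonneg _),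
        Real.sqrt_sq (hlam0 k).le]
    rw [hsq] at h
    have hspos : 0 < Real.sqrt (-s) := Real.sqrt_pos.2 (by linarith)
    show ‖(lam k • stPull (lam k ^ 2) (lam k) z₀.1 z₀.2 u) s y‖ ≤ M / Real.sqrt (-s)
    rw [smul_stPull_apply, norm_smul, Real.norm_of_nonneg (hlam0 k).le, le_div_iff₀ hspos]
    have h' := (le_div_iff₀ (mul_pos (hlam0 k) hspos)).1 h
    calc lam k * ‖u (z₀.1 + lam k ^ 2 * s) (z₀.2 + lam k • y)‖ * Real.sqrt (-s)
        = ‖u (z₀.1 + lam k ^ 2 * s) (z₀.2 + lam k • y)‖ * (lam k * Real.sqrt (-s)) := by ring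
      _ ≤ M := h'
  -- ## Step 3: compactness with persistence of the singularity and the class on every ball
  obtain ⟨Ut, Pt, Ht, σ, hσ, hswU, hHU, h4I, hInBallU, hmemU, hconvU, hpers⟩ :=
    local_typeI_compactness_inBall I v qz Gz hI (fun m k hmk => hballs m k (by omega))
      (fun m k hmk => hgrads m k (by omega)) (fun m k hmk => hIs m k (by omega))
  have hσge : ∀ j, j ≤ σ j := fun j => hσ.id_le j
  have hsingU : IsBackwardSingularPoint Ut 0 := hpers fun r hr => by
    simp only [hblow _ r hr]
    exact limsup_const ⊤
  have h4Itop : typeIBound (Iio (0 : ℝ) ×ˢ univ) Ut Pt Ht < ⊤ :=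
    lt_of_le_of_lt h4I (ENNReal.mul_lt_top (by simp) hI)
  -- ## Step 4: the rate, almost everywhere on the slab
  have hrate_ae : ∀ᵐ w ∂(volume.restrict (Iio (0 : ℝ) ×ˢ (univ : Set (EuclideanSpace ℝ (Fin 3))))),
      ‖Ut w.1 w.2‖ ≤ M / Real.sqrt (-w.1) := by
    have hQ : ∀ m : ℕ, ∀ᵐ w ∂(volume.restrict (parabolicCylinder ((2 : ℝ) ^ m) (0 : ℝ × (EuclideanSpace ℝ (Fin 3))))),
        ‖Ut w.1 w.2‖ ≤ M / Real.sqrt (-w.1) := by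
      intro m
      have hmeas : ∀ j, AEStronglyMeasurable (uncurry (v (σ (j + m))))
          (volume.restrict (parabolicCylinder ((2 : ℝ) ^ m) (0 : ℝ × (EuclideanSpace ℝ (Fin 3))))) := fun j =>
        (hballs m (σ (j + m)) (by linarith [hσge (j + m)])).1.distributional.1.aestronglyMeasurable
      obtain ⟨ψ₁, hψ₁, hae⟩ := (tendstoInMeasure_of_tendsto_eLpNorm (by norm_num) hmeas
        (hmemU _ (hcc_pos m)).1 ((hconvU _ (hcc_pos m)).comp (tendsto_add_atTop_nat m))).exists_seq_tendsto_ae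
      filter_upwards [hae, ae_restrict_mem (isOpen_parabolicCylinder _ _).measurableSet] with w hw hwmem
      refine le_of_tendsto hw.norm (Eventually.of_forall fun i => ?_)
      have hle : m ≤ σ (ψ₁ i + m) + 2 := by linarith [hσge (ψ₁ i + m)]
      exact hratev _ w (hsub m _ hle hwmem)
    exact ae_restrict_of_ae_restrict_of_subset lowerHalf_subset_iUnion_two_pow
      ((ae_restrict_iUnion_iff _ _).2 hQ)
  -- ## Step 5: the representatives (rate everywhere; continuous Oseen-mild)
  obtain ⟨U₁, hae₁, hsw₁, hwg₁, hI₁, hdec₁, hsing₁⟩ :=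
    exists_rate_profile_repr hM hswU hHU h4Itop hsingU hrate_ae
  obtain ⟨U, hae₂, hUc, hUdiv, hUmild, hUrate⟩ := exists_oseenMild_repr_of_typeIBound_lt_top hsw₁ hdec₁ hI₁
  have hae₂' : ∀ᵐ w ∂(volume.restrict ((slab (EuclideanSpace ℝ (Fin 3)) (Iio 0) isOpen_Iio :
      Opens (ℝ × (EuclideanSpace ℝ (Fin 3)))) : Set (ℝ × (EuclideanSpace ℝ (Fin 3))))),
      uncurry U₁ w = uncurry U w := by
    rw [coe_slab]
    exact hae₂
  have hwgU' : HasWeakSpatialGradientOn (slab (EuclideanSpace ℝ (Fin 3)) (Iio 0) isOpen_Iio) U Ht :=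
    hwg₁.congr_ae hae₂'
  have hIU' : typeIBound (Iio (0 : ℝ) ×ˢ univ) U Pt Ht < ⊤ := by
    rwa [← typeIBound_congr_ae hae₂]
  have hsingU' : IsBackwardSingularPoint U 0 :=
    hsing₁.congr_ae (fun r _ => parabolicCylinder_origin_subset_slab r) hae₂
  have hTI : IsTypeIAncientMild M U := isTypeIAncientMild_of_continuous_oseenMild_rate hUc hUdiv hUmild hUrate
  have haeU : ∀ᵐ w ∂(volume.restrict (Iio (0 : ℝ) ×ˢ (univ : Set (EuclideanSpace ℝ (Fin 3))))),
      uncurry Ut w = uncurry U w := by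
    filter_upwards [hae₁, hae₂] with w h1 h2
    rw [h1, h2]
  have haeU_ball : ∀ a : ℝ, ∀ᵐ w ∂(volume.restrict (parabolicCylinder a (0 : ℝ × (EuclideanSpace ℝ (Fin 3))))),
      uncurry Ut w = uncurry U w := fun a =>
    ae_restrict_of_ae_restrict_of_subset (parabolicCylinder_origin_subset_slab a) haeU
  -- ## Step 6: the null weak top trace
  have htoptrace : ∀ φ : EuclideanSpace ℝ (Fin 3) → EuclideanSpace ℝ (Fin 3), ContDiff ℝ (⊤ : ℕ∞) φ →
      HasCompactSupport φ → ∀ ε : ℝ, 0 < ε →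
      ∃ s₀ : ℝ, s₀ < 0 ∧ ∀ᵐ s ∂(volume.restrict (Ioo s₀ 0)), |∫ y, ⟪U s y, φ y⟫| ≤ ε := by
    intro φ hφ hφc ε hε
    -- (a) a ball `B(0, 2ᵐ)` containing the support of `φ`
    obtain ⟨r, hr⟩ := hφc.isCompact.isBounded.subset_closedBall (0 : EuclideanSpace ℝ (Fin 3))
    obtain ⟨m, hm⟩ := pow_unbounded_of_one_lt (|r| + 1) (by norm_num : (1 : ℝ) < 2)
    set a : ℝ := (2 : ℝ) ^ m with ha_def
    have ha : 0 < a := hcc_pos m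
    have ha1 : 1 ≤ a := hcc_one m
    set Q : Set (ℝ × EuclideanSpace ℝ (Fin 3)) :=
      parabolicCylinder a (0 : ℝ × EuclideanSpace ℝ (Fin 3)) with hQdef
    set B : Set (EuclideanSpace ℝ (Fin 3)) := ball (0 : EuclideanSpace ℝ (Fin 3)) a with hBdef
    have hsupp : tsupport φ ⊆ B := fun x hx => by
      have h1 := hr hx
      rw [mem_closedBall, dist_zero_right] at h1
      rw [hBdef, mem_ball, dist_zero_right]
      linarith [le_abs_self r]
    have hφ' : FunctionSpaces.IsTestFunctionOn (⟨B, isOpen_ball⟩ : Opens (EuclideanSpace ℝ (Fin 3))) φ :=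
      ⟨hφ, hφc, hsupp⟩
    obtain ⟨K₀, K₁, K₂, hK₀, hK₁, hK₂⟩ := exists_bounds_of_isTestFunctionOn hφ'
    have hK₁0 : 0 ≤ K₁ := (norm_nonneg _).trans (hK₁ 0)
    have hK₂0 : 0 ≤ K₂ := (norm_nonneg _).trans (hK₂ 0)
    -- (b) the normalised pressures and the uniform constants at level `m`
    set qn : ℕ → ℝ → (EuclideanSpace ℝ (Fin 3)) → ℝ :=
      fun k t x => qz k t x - ⨍ y in ball (0 : (EuclideanSpace ℝ (Fin 3))) 1, qz k t y with hqn
    have h0 : ∀ k t, ⨍ y in ball (0 : (EuclideanSpace ℝ (Fin 3))) 1, qn k t y = 0 := fun k t =>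
      unitBallMean_normalised (qz k) t
    have hlev : ∀ j, m ≤ σ (j + m) + 2 := fun j => by linarith [hσge (j + m)]
    have hballn : ∀ j, IsSuitableWeakSolutionInBall a 0 (v (σ (j + m))) (qn (σ (j + m))) := fun j =>
      isSuitableWeakSolutionInBall_sub_unitBallMean ha1 (hballs m _ (hlev j))
    have hbdn : ∀ j, typeIBound Q (v (σ (j + m))) (qn (σ (j + m))) (Gz (σ (j + m))) ≤ I := by
      intro j
      show typeIBound _ (v (σ (j + m)))
        (fun t x => qz (σ (j + m)) t x -
          ⨍ y in ball (0 : (EuclideanSpace ℝ (Fin 3))) 1, qz (σ (j + m)) t y) (Gz (σ (j + m))) ≤ I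
      rw [typeIBound_sub_unitBallMean_ball (hballs m _ (hlev j)).2.2.2]
      exact hIs m _ (hlev j)
    set A : ℝ≥0∞ := ENNReal.ofReal a * I with hAdef
    have hAtop : A ≠ ⊤ := ENNReal.mul_ne_top ENNReal.ofReal_ne_top hItop
    have hA : ∀ j, ∀ᵐ t ∂(volume.restrict (Ioo ((0 : ℝ × EuclideanSpace ℝ (Fin 3)).1 - a ^ 2)
        (0 : ℝ × EuclideanSpace ℝ (Fin 3)).1)),
        ∫⁻ x in ball (0 : ℝ × EuclideanSpace ℝ (Fin 3)).2 a, ‖v (σ (j + m)) t x‖ₑ ^ 2 ≤ A := fun j =>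
      ae_lintegral_ball_sq_le_of_typeIBound_le ha (hbdn j)
    set Cq : ℝ≥0∞ := (2 * (1 + volume (ball (0 : (EuclideanSpace ℝ (Fin 3))) a) *
        (volume (ball (0 : (EuclideanSpace ℝ (Fin 3))) 1))⁻¹) * (ENNReal.ofReal a ^ 2 * I)) ^ (2 / 3 : ℝ)
      with hCqdef
    have hCqtop : Cq ≠ ⊤ := by
      refine (ENNReal.rpow_lt_top_of_nonneg (by norm_num) ?_).ne
      rw [← mul_assoc]
      exact ENNReal.mul_ne_top (pressureConst_lt_top a).ne hItop
    have hPq : ∀ j, eLpNorm (uncurry (qn (σ (j + m)))) (3 / 2) (volume.restrict Q) ≤ Cq := by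
      intro j
      refine (eLpNorm_pressure_ball_le ha1 (hballn j).2.2.2.1 (h0 _) Subset.rfl
        (v (σ (j + m))) (Gz (σ (j + m)))).trans ?_
      exact ENNReal.rpow_le_rpow (mul_le_mul' le_rfl (mul_le_mul' le_rfl (hbdn j))) (by norm_num)
    -- (c) the top values of the zooms and their limit `0`
    set L : ℕ → ℝ := fun k => ∫ x in B, ⟪v k 0 x, φ x⟫ with hLdef
    have hL : ∀ k, Tendsto (fun s => ∫ x in B, ⟪v k s x, φ x⟫)
        (𝓝[<] (0 : ℝ × EuclideanSpace ℝ (Fin 3)).1) (𝓝 (L k)) := fun k =>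
      tendsto_setIntegral_inner_zoom_nhdsLT hwc hφ hφc hsupp (hlam0 k)
    have hca : ∀ j, lam (σ (j + m)) * a ≤ ρ := fun j => by
      have h := hbig (σ (j + m))
      rw [le_div_iff₀ (hlam0 _)] at h
      calc lam (σ (j + m)) * a ≤ lam (σ (j + m)) * (2 : ℝ) ^ (σ (j + m) + 2) :=
            mul_le_mul_of_nonneg_left (pow_le_pow_right₀ (by norm_num) (hlev j)) (hlam0 _).le
        _ ≤ ρ := by rw [mul_comm]; exact h
    have hlamj : Tendsto (fun j => lam (σ (j + m))) atTop (𝓝 0) :=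
      hlamlim.comp ((hσ.tendsto_atTop).comp (tendsto_add_atTop_nat m))
    have hLlim : Tendsto (fun j => L (σ (j + m))) atTop (𝓝 0) :=
      tendsto_setIntegral_inner_zoom_zero hρ htop htopm hK₀ ha (fun j => hlam0 _) hca hlamj
    -- (d) the uniform modulus for every zoom at level `m`
    have hmod : ∀ j, ∀ᵐ s ∂(volume.restrict (Ioo ((0 : ℝ × EuclideanSpace ℝ (Fin 3)).1 - a ^ 2)
        (0 : ℝ × EuclideanSpace ℝ (Fin 3)).1)),
        |(∫ x in B, ⟪v (σ (j + m)) s x, φ x⟫) - L (σ (j + m))| ≤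
          (K₁ * A.toReal + K₂ * ((volume B).toReal + A.toReal)) *
              ((0 : ℝ × EuclideanSpace ℝ (Fin 3)).1 - s) +
            3 * K₁ * Cq.toReal * (volume B).toReal ^ (1 / 3 : ℝ) *
              ((0 : ℝ × EuclideanSpace ℝ (Fin 3)).1 - s) ^ (1 / 3 : ℝ) := fun j =>
      ae_abs_pairing_sub_top_le (hballn j) ha hAtop (hA j) hCqtop (hPq j) hφ' hK₁ hK₂ (hL _)
    -- (e) passage to the limit
    have hw : ∀ j, IntegrableOn (uncurry (v (σ (j + m)))) Q volume := fun j =>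
      (integrable_data (hballn j) hAtop (hA j)).1
    have hW : IntegrableOn (uncurry Ut) Q volume := by
      haveI := isFiniteMeasure_restrict_parabolicCylinder' a (0 : ℝ × EuclideanSpace ℝ (Fin 3))
      exact (hmemU a ha).integrable (by norm_num)
    have hconv : Tendsto (fun j => ∫⁻ q in Q, ‖uncurry (v (σ (j + m))) q - uncurry Ut q‖ₑ)
        atTop (𝓝 0) := by
      have h3 := (hconvU a ha).comp (tendsto_add_atTop_nat m)
      have hvolQ : volume Q ≠ ⊤ := (volume_parabolicCylinder_lt_top' a _).ne
      have hle : ∀ j, ∫⁻ q in Q, ‖uncurry (v (σ (j + m))) q - uncurry Ut q‖ₑ ≤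
          eLpNorm (uncurry (v (σ (j + m))) - uncurry Ut) 3 (volume.restrict Q) *
            volume Q ^ (2 / 3 : ℝ) := fun j =>
        lintegral_enorm_le_eLpNorm_three_mul ((hw j).1.sub hW.1)
      have h0 : Tendsto (fun j => eLpNorm (uncurry (v (σ (j + m))) - uncurry Ut) 3
          (volume.restrict Q) * volume Q ^ (2 / 3 : ℝ)) atTop (𝓝 0) := by
        have h := ENNReal.Tendsto.mul_const h3
          (Or.inr (ENNReal.rpow_ne_top_of_nonneg (show (0 : ℝ) ≤ 2 / 3 by norm_num) hvolQ))
        rwa [zero_mul] at h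
      exact tendsto_of_tendsto_of_tendsto_of_le_of_le tendsto_const_nhds h0 (fun _ => bot_le) hle
    have hlimit := ae_abs_setIntegral_inner_le_of_tendsto hw hW hconv hφ.continuous hK₀ hLlim hmod
    -- (f) the choice of `s₀`
    obtain ⟨δ, hδ, -, hδε⟩ := exists_delta_modulus_le
      (K := K₁ * A.toReal + K₂ * ((volume B).toReal + A.toReal))
      (K' := 3 * K₁ * Cq.toReal * (volume B).toReal ^ (1 / 3 : ℝ))
      (add_nonneg (mul_nonneg hK₁0 ENNReal.toReal_nonneg)
        (mul_nonneg hK₂0 (add_nonneg ENNReal.toReal_nonneg ENNReal.toReal_nonneg)))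
      (mul_nonneg (mul_nonneg (mul_nonneg (by norm_num) hK₁0) ENNReal.toReal_nonneg)
        (Real.rpow_nonneg ENNReal.toReal_nonneg _)) hε
    set s₀ : ℝ := -min δ (a ^ 2) with hs₀def
    have hmin : 0 < min δ (a ^ 2) := lt_min hδ (pow_pos ha 2)
    have hs₀ : s₀ < 0 := by rw [hs₀def]; linarith
    refine ⟨s₀, hs₀, ?_⟩
    have hsubI : Ioo s₀ 0 ⊆ Ioo ((0 : ℝ × EuclideanSpace ℝ (Fin 3)).1 - a ^ 2)
        (0 : ℝ × EuclideanSpace ℝ (Fin 3)).1 := by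
      show Ioo s₀ 0 ⊆ Ioo ((0 : ℝ) - a ^ 2) 0
      refine Ioo_subset_Ioo_left ?_
      rw [hs₀def]
      linarith [min_le_right δ (a ^ 2)]
    have h1 := ae_restrict_of_ae_restrict_of_subset hsubI hlimit
    have h2 : ∀ᵐ s ∂(volume.restrict (Ioo ((0 : ℝ × EuclideanSpace ℝ (Fin 3)).1 - a ^ 2)
        (0 : ℝ × EuclideanSpace ℝ (Fin 3)).1)),
        ∀ᵐ x ∂(volume.restrict (ball (0 : ℝ × EuclideanSpace ℝ (Fin 3)).2 a)),
          uncurry Ut (s, x) = uncurry U (s, x) := by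
      have h := haeU_ball a
      rw [volume_restrict_parabolicCylinder] at h
      exact Measure.ae_ae_of_ae_prod h
    have h2' := ae_restrict_of_ae_restrict_of_subset hsubI h2
    filter_upwards [h1, h2', ae_restrict_mem measurableSet_Ioo] with s hs hs2 hsI
    have e1 : ∫ y, ⟪U s y, φ y⟫ = ∫ y in B, ⟪U s y, φ y⟫ :=
      (setIntegral_inner_eq_integral_of_tsupport_subset hsupp).symm
    have e2 : ∫ y in B, ⟪U s y, φ y⟫ = ∫ y in B, ⟪Ut s y, φ y⟫ :=
      integral_congr_ae (by
        filter_upwards [hs2] with x hx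
        simp only [uncurry] at hx
        rw [hx])
    rw [e1, e2]
    refine hs.trans ?_
    have hσpos : 0 < (0 : ℝ × EuclideanSpace ℝ (Fin 3)).1 - s := by
      show 0 < (0 : ℝ) - s
      linarith [hsI.2]
    have hσδ : (0 : ℝ × EuclideanSpace ℝ (Fin 3)).1 - s < δ := by
      show (0 : ℝ) - s < δ
      have := hsI.1
      rw [hs₀def] at this
      linarith [min_le_left δ (a ^ 2)]
    exact hδε _ hσpos hσδ
  -- ## conclusion
  refine ⟨U, Pt, Ht, (typeIBound (Iio (0 : ℝ) ×ˢ univ) U Pt Ht).toNNReal, M, fun a _ => ?_,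
    fun a _ => ?_, fun a _ => ?_, fun s hs => ?_, htoptrace, hsingU'⟩
  · exact (hInBallU a ‹_›).congr_ae' (haeU_ball a) (ae_of_all _ fun _ => rfl)
  · exact hwgU'.mono fun w hw => parabolicCylinder_origin_subset_slab a hw
  · exact (typeIBound_mono (parabolicCylinder_origin_subset_slab a)).trans
      (le_of_eq (ENNReal.coe_toNNReal hIU'.ne).symm)
  · exact ae_of_all _ fun y => hTI.hasTypeITimeDecay s hs y

end Summit.NavierStokesRegularity.NavierStokesRegularity.Theorems.TerminalTraceExtinctApexZoom

end
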